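import Summits.BirchSwinnertonDyer.BirchSwinnertonDyer.Theses.PrintX10b
import Summits.BirchSwinnertonDyer.BirchSwinnertonDyer.Theorems.PrintX10bHowardContainmentAnyClassNumberX10bThm413Hyp
import Summits.BirchSwinnertonDyer.BirchSwinnertonDyer.Theorems.PrintX9HowardContainmentLightFrameOfPrintDepthPosLocalized
import Literature.NumberTheory.EllipticCurves.CastellaGrossiSkinner2025.HeegnerKolyvaginBoundAnyClassNumber
import Literature.NumberTheory.EllipticCurves.IwasawaAlgebraPromotionProofs
import HarnessLib

/-!
# Line `torsion-depth-x10b-pinned` on the DECIDING crux stmt-BirchSwinnertonDyer-26623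
# `PrintX10b.HowardContainmentAnyClassNumberX10bPinnedOfPrint` (PrintX10b rev 20, r303; the PIN-1-repaired
# OfPrint re-type of stmt-23729, filed 2026-08-28T07:28Z with the BROAD A₃^pin text stmt-26621)

Crux (by name): `HowardContainmentAnyClassNumberX10bPinnedOfPrint :=
MastellaZermanHowardDivisibility → CGLSHowardDivisibilityLocalized → AnticyclotomicTowerInRingClassFields →
HowardContainmentAnyClassNumberX10bPinned`, the latter = Howard's containment `I(ℋ_F)² ⊆ char_Λ(X_tors)` TIED
(`F.Dt = Dt`) and PINNED (`¬ (p : ℤ) ∣ Dt.c`) on EVERY non-CM X10b Heegner frame `K` with `d_K ∉ {-3, -4}` —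
NO parity-of-`d_K`, rank, `Ш` or (irr_K) binder (the BROAD text; x10b-p2's TURNKEY-2 asked for LIGHT / ODD).

Seat `bsd-line-x10b-p2` LEAD g2 (line of record `torsion_depth_x10b` on 23729 transferred here). HONEST
FRAMING: a SKELETON — sorries ONLY in the four `stub_*` marked OPEN; the composition
`HowardContainmentAnyClassNumberX10bPinnedOfPrint_of` is sorry-free and concludes the crux BY NAME; nothing is
closed; no summit statement is proved; BSD is not proved by any of this.

REGIME SPLIT (torsion-depth dictionary of the X9 skeleton of record `torsion-depth-pinned` on 26359, plus the
two regimes the BROAD text adds):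
* `stub_coprimeTied` — `3 ∤ h_K`, ANY `d_K ∉ {-3,-4}`: PROVED from `hMZ` (MZ26 Cor. 4.6 BY NAME) via the landed
  `X10.heegnerContainmentPinned_of_cor46_of_not_surj` (p607508). PRINT.
* `stub_envelopeTied` — OPEN (M–L, print modulo typing): the Heegner-module ENVELOPE for the GIVEN `jbar` and
  EVERY `D`, OUTPUT form `(C, F, e)` on the frame's `Dt` — the twin of 26359's `stub_envelopeTied` (x9-p2 +
  x9-p1 LEAD engine, p-generic: p610688 / p611154 / p611771 / p608989 / p610853 …); stated on all broad frames
  (the engine is `d_K`-agnostic; (irr_K) for `E(K_n)[3] = 0` is a THEOREM here: Matar–Nekovář 5.26 (2)).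
* `stub_pLocalizedStabilized` — OPEN AS A STUB, PRINT AS A FACT: on ODD-`d_K` frames, for every `(D, C, X)`,
  `∃ m, (3^m)·I(Λκ_∞(C))² ⊆ char_Λ(X_tors)` with NO `(γ-1)`-power and NO corank premiss = Castella–Grossi–Skinner
  2025 Thm. 6.5.2 at any class number, TYPED (`CastellaGrossiSkinner2025.thm652_stabilized_rankOne_charIdeal_
  torsion_dvd_pLocalized`, p610515) and discharged CONDITIONALLY on it by the landed-shape theorem
  `X10.pLocalizedStabilizedContainment_of_thm652` — but that fact is NOT a binder of this crux (the binder `hCGLS`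
  = CGLS 4.1.3 gives `(3^m)(γ-1)^n` and drops `(γ-1)^n` only at Selmer corank one, which A₃^pin's frames do not
  carry). ⇒ `stub-blocked: CastellaGrossiSkinner2025.thm652_stabilized_rankOne_charIdeal_torsion_dvd_pLocalized`
  until the pen binds it (rev 21: support `CGSHowardDivisibilityPLocalized` + OfPrint re-type), whereupon the stub
  is `hCGS` instantiated and disappears (variant file `Lines/torsion_depth_x10b_pinned_broad.lean`).
* `stub_muPartTied` — OPEN, HARDEST: the μ-part for the pinned family (odd `d_K`) = in the kernel EXACTLY the
  μ-INEQUALITY `μ(X_tors) ≤ 2·μ(𝔖/ℋ_F)` (`muPartTied_of_muInequality`, over x10b-p1's sharp promotion lemma;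
  idea-16 g2's target correction) — BEYOND CITABLE PRINT at `3 ∣ h_K` (REF-118: MZ26 Thm 3.15 carries standing Ass. 2.1 (iii)
  p ∤ h_K load-bearingly; portable — census §μ); the stronger `μ(X_tors) = 0` also suffices
  (`muPartTied_of_muInvariant_eq_zero`, p607965).
* `stub_evenDiscTied` — OPEN, NO SOURCE: even `d_K ≠ -4` at `3 ∣ h_K` — CGLS 2022 / CGS 2025 carry (disc) =
  `d_K` odd, MZ26 / Howard carry `p ∤ h_K`; no consumer of A₃ ever instantiates it (all supply `Odd d_K`).
  ⇒ `stub-misstated` candidate: drop by adding `Odd (NumberField.discr K)` to A₃^pin (rev 21).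
Composition: fix the frame, `jbar := IsAlgClosed.lift` along `ιC`; `3 ∤ h_K` ↦ s_cop; `3 ∣ h_K`: even `d_K` ↦
s_even; odd `d_K` ↦ `D`, `X` exist; `(C, F, e)` ← s_env hTw; `m` ← s_pLoc at `(D, C, X)`; `Module.Finite X.X` ←
`hCGLS` (rank clause, hypotheses `X10.thm413Hypotheses_of_classX10`); `(3^{m+2e})·I(ℋ_F)² ⊆ char` ⇒ s_mu.
Disproof / negatives: none on file for 26623 / 26621 (new decls); 23729's crux dir has no Disproof.lean.
-/

set_option linter.dupNamespace false
set_option autoImplicit false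

noncomputable section

open scoped Classical
open Literature Literature.NumberTheory.EllipticCurves WeierstrassCurve
  Literature.NumberTheory.EllipticCurves.ModularForms
open Literature.NumberTheory.EllipticCurves.Rank1Residual (ClassX10 Surj)
open Summit.BirchSwinnertonDyer.BirchSwinnertonDyer.Theses.PrintX10b
  (MastellaZermanHowardDivisibility CGLSHowardDivisibilityLocalized AnticyclotomicTowerInRingClassFields
    HowardContainmentAnyClassNumberX10bPinned HowardContainmentAnyClassNumberX10bPinnedOfPrint)

namespace Summit.BirchSwinnertonDyer.BirchSwinnertonDyer.Cruxes.HowardContainmentAnyClassNumberX10bPinnedOfPrint.TorsionDepthX10bPinned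

/-! ## §1 Stub statements (the BROAD X10b frame binders of stmt-26621, verbatim, plus a GIVEN `jbar`) -/

/-- s_cop: the `3 ∤ h_K` regime, tied, every `d_K ∉ {-3,-4}` (MZ26 Cor. 4.6 by name). -/
def Stmt.coprimeTied : Prop :=
  MastellaZermanHowardDivisibility →
    ∀ (W : WeierstrassCurve ℚ) [W.IsElliptic] [W.IsGloballyMinimal] (p : ℕ) [Fact p.Prime]
      [NeZero (W.conductorNorm ℤ)] (K : Type) [Field K] [NumberField K],
      ClassX10 W p → ¬ Surj W 3 → ¬ W.HasCM →
      IsImaginaryQuadratic K → NumberField.discr K ≠ -3 → NumberField.discr K ≠ -4 →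
      SatisfiesHeegnerHypothesis (W.conductorNorm ℤ) K → SatisfiesHeegnerHypothesis p K →
      ∀ (κ : ZpExtension K p), κ.IsAnticyclotomic → ∀ (γ : Field.absoluteGaloisGroup K),
      κ.IsTopGenerator γ →
      ∀ (Dt : ModularParametrizationData W (W.conductorNorm ℤ))
        (H : HeegnerDatum (W.conductorNorm ℤ) (NumberField.discr K)) (ιC : K →+* ℂ)
        (jbar : AlgebraicClosure K →+* ℂ),
      ¬ (p : ℤ) ∣ Dt.c → ¬ p ∣ NumberField.classNumber K →
      ∃ (D : (W.baseChange K).LambdaAdicSelmerData κ γ)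
        (F : HeegnerFamily (W.conductorNorm ℤ) W K κ jbar) (X : (W.baseChange K).SelmerDualData κ γ),
        F.Dt = Dt ∧ heegnerCharIdeal D F ^ 2 ≤
          Module.charIdeal (IwasawaAlgebra p) (Submodule.torsion (IwasawaAlgebra p) X.X)

/-- s_env: the Heegner-module ENVELOPE on a BROAD X10b frame, for the GIVEN `jbar` and EVERY `Λ`-adic Selmer
datum `D`: the stub OUTPUTS a CGLS `d(k)`-shifted stabilized datum `C` and a Heegner family `F`, BOTH on the
frame's `Dt` (built on ONE principal CM system — coherent), and `e : ℕ` with `(p^e)·I(ℋ_F) ⊆ I(Λκ_∞(C))` and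
`𝔖/ℋ_F` torsion. Twin of 26359's `Stmt.envelopeTied` with the X10b BROAD frame. Content p-generic and
`d_K`-agnostic: generation `ℋ_F` vs `Λκ_∞(C)` (Howard 2004 §3.3 / Thm. 3.3.7 at `p ∤ h_K`; CGLS 2022 §4.1
`d(k)`-shift, Rem. 4.1.4 at any class number; vertical distribution relations — x9-p1 LEAD p611154/p611771),
non-torsion (CGLS Thm. 4.1.1 / Cornut–Vatsal — lit p610772), `E(K_n)[3] = 0` along the tower from (irr_K)
(`PrintX9Rescaling.fixedGeomPoints_eq_zero_…`; (irr_K) is Matar–Nekovář 5.26 (2) `…_baseChange_holds` here). -/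
def Stmt.envelopeTied : Prop :=
  AnticyclotomicTowerInRingClassFields →
    ∀ (W : WeierstrassCurve ℚ) [W.IsElliptic] [W.IsGloballyMinimal] (p : ℕ) [Fact p.Prime]
      [NeZero (W.conductorNorm ℤ)] (K : Type) [Field K] [NumberField K],
      ClassX10 W p → ¬ Surj W 3 → ¬ W.HasCM →
      IsImaginaryQuadratic K → NumberField.discr K ≠ -3 → NumberField.discr K ≠ -4 →
      SatisfiesHeegnerHypothesis (W.conductorNorm ℤ) K → SatisfiesHeegnerHypothesis p K →
      ∀ (κ : ZpExtension K p), κ.IsAnticyclotomic → ∀ (γ : Field.absoluteGaloisGroup K),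
      κ.IsTopGenerator γ →
      ∀ (Dt : ModularParametrizationData W (W.conductorNorm ℤ))
        (H : HeegnerDatum (W.conductorNorm ℤ) (NumberField.discr K))
        (jbar : AlgebraicClosure K →+* ℂ) (D : (W.baseChange K).LambdaAdicSelmerData κ γ),
      ¬ (p : ℤ) ∣ Dt.c →
      ∃ (C : CastellaGrossiLeeSkinner2022.StabilizedHeegnerData (W.conductorNorm ℤ) W K κ jbar)
        (F : HeegnerFamily (W.conductorNorm ℤ) W K κ jbar) (e : ℕ),
        C.Dt = Dt ∧ F.Dt = Dt ∧
        Ideal.span {((p : IwasawaAlgebra p) ^ e)} * heegnerCharIdeal D F ≤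
          CastellaGrossiLeeSkinner2022.stabilizedHeegnerCharIdeal D C ∧
        Module.IsTorsion (IwasawaAlgebra p) (D.S ⧸ heegnerModule D F)

/-- s_pLoc: the `3`-LOCALIZED containment in the STABILIZED currency on ODD-`d_K` X10b frames, for EVERY
`(D, C, X)`, with NO `(γ - 1)`-power and NO corank premiss: `∃ m, (3^m)·I(Λκ_∞(C))² ⊆ char_Λ(X_tors)`. PRINT:
Castella–Grossi–Skinner 2025 Thm. 6.5.2 at any class number (typed: p610515; conditional discharge
`pLocalizedStabilized_of_thm652` below). NOT derivable from the crux binder `hCGLS` off corank one. -/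
def Stmt.pLocalizedStabilized : Prop :=
    ∀ (W : WeierstrassCurve ℚ) [W.IsElliptic] [W.IsGloballyMinimal] (p : ℕ) [Fact p.Prime]
      [NeZero (W.conductorNorm ℤ)] (K : Type) [Field K] [NumberField K],
      ClassX10 W p → ¬ Surj W 3 → ¬ W.HasCM →
      IsImaginaryQuadratic K → NumberField.discr K ≠ -3 → NumberField.discr K ≠ -4 →
      SatisfiesHeegnerHypothesis (W.conductorNorm ℤ) K → SatisfiesHeegnerHypothesis p K →
      ∀ (κ : ZpExtension K p), κ.IsAnticyclotomic → ∀ (γ : Field.absoluteGaloisGroup K),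
      κ.IsTopGenerator γ → ∀ (jbar : AlgebraicClosure K →+* ℂ),
      Odd (NumberField.discr K) →
      ∀ (D : (W.baseChange K).LambdaAdicSelmerData κ γ)
        (C : CastellaGrossiLeeSkinner2022.StabilizedHeegnerData (W.conductorNorm ℤ) W K κ jbar)
        (X : (W.baseChange K).SelmerDualData κ γ),
      ∃ m : ℕ, Ideal.span {((p : IwasawaAlgebra p) ^ m)} *
          CastellaGrossiLeeSkinner2022.stabilizedHeegnerCharIdeal D C ^ 2 ≤
        Module.charIdeal (IwasawaAlgebra p) (Submodule.torsion (IwasawaAlgebra p) X.X)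

/-- s_mu: the μ-part at `3 ∣ h_K` on ODD-`d_K` frames — family-localized TIED ⟹ integral TIED; the hypothesis
carries what the composition has in hand at that point (`Module.Finite Λ 𝔖`, `Module.Finite Λ 𝒳` from CGLS 4.1.3's
rank clauses; `𝔖/ℋ_F` torsion from the envelope), so that the stub is EXACTLY the μ-INEQUALITY
`μ(X_tors) ≤ 2·μ(𝔖/ℋ_F)` in disguise (`muPartTied_of_muInequality` below; idea-16 g2's kernel-target correction:
the A-side method gives the inequality, not `μ(X_tors) = 0`). Print status: see the census. -/
def Stmt.muPartTied : Prop :=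
    ∀ (W : WeierstrassCurve ℚ) [W.IsElliptic] [W.IsGloballyMinimal] (p : ℕ) [Fact p.Prime]
      [NeZero (W.conductorNorm ℤ)] (K : Type) [Field K] [NumberField K],
      ClassX10 W p → ¬ Surj W 3 → ¬ W.HasCM →
      IsImaginaryQuadratic K → NumberField.discr K ≠ -3 → NumberField.discr K ≠ -4 →
      SatisfiesHeegnerHypothesis (W.conductorNorm ℤ) K → SatisfiesHeegnerHypothesis p K →
      ∀ (κ : ZpExtension K p), κ.IsAnticyclotomic → ∀ (γ : Field.absoluteGaloisGroup K),
      κ.IsTopGenerator γ →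
      ∀ (Dt : ModularParametrizationData W (W.conductorNorm ℤ))
        (H : HeegnerDatum (W.conductorNorm ℤ) (NumberField.discr K)) (ιC : K →+* ℂ)
        (jbar : AlgebraicClosure K →+* ℂ),
      ¬ (p : ℤ) ∣ Dt.c → Odd (NumberField.discr K) → p ∣ NumberField.classNumber K →
      (∃ (D : (W.baseChange K).LambdaAdicSelmerData κ γ)
          (F : HeegnerFamily (W.conductorNorm ℤ) W K κ jbar) (X : (W.baseChange K).SelmerDualData κ γ) (m : ℕ),
          F.Dt = Dt ∧ Module.Finite (IwasawaAlgebra p) D.S ∧ Module.Finite (IwasawaAlgebra p) X.X ∧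
          Module.IsTorsion (IwasawaAlgebra p) (D.S ⧸ heegnerModule D F) ∧
          Ideal.span {((p : IwasawaAlgebra p) ^ m)} * heegnerCharIdeal D F ^ 2 ≤
            Module.charIdeal (IwasawaAlgebra p) (Submodule.torsion (IwasawaAlgebra p) X.X)) →
      ∃ (D : (W.baseChange K).LambdaAdicSelmerData κ γ)
        (F : HeegnerFamily (W.conductorNorm ℤ) W K κ jbar) (X : (W.baseChange K).SelmerDualData κ γ),
        F.Dt = Dt ∧ heegnerCharIdeal D F ^ 2 ≤
          Module.charIdeal (IwasawaAlgebra p) (Submodule.torsion (IwasawaAlgebra p) X.X)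

/-- s_even: the whole tied containment on EVEN-`d_K` (`≠ -4`) X10b frames at `3 ∣ h_K`. NO SOURCE (typed or
untyped); no consumer instantiates it. Candidate `stub-misstated` ⇒ add `Odd (NumberField.discr K)` to A₃^pin. -/
def Stmt.evenDiscTied : Prop :=
    ∀ (W : WeierstrassCurve ℚ) [W.IsElliptic] [W.IsGloballyMinimal] (p : ℕ) [Fact p.Prime]
      [NeZero (W.conductorNorm ℤ)] (K : Type) [Field K] [NumberField K],
      ClassX10 W p → ¬ Surj W 3 → ¬ W.HasCM →
      IsImaginaryQuadratic K → NumberField.discr K ≠ -3 → NumberField.discr K ≠ -4 →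
      SatisfiesHeegnerHypothesis (W.conductorNorm ℤ) K → SatisfiesHeegnerHypothesis p K →
      ∀ (κ : ZpExtension K p), κ.IsAnticyclotomic → ∀ (γ : Field.absoluteGaloisGroup K),
      κ.IsTopGenerator γ →
      ∀ (Dt : ModularParametrizationData W (W.conductorNorm ℤ))
        (H : HeegnerDatum (W.conductorNorm ℤ) (NumberField.discr K)) (ιC : K →+* ℂ)
        (jbar : AlgebraicClosure K →+* ℂ),
      ¬ (p : ℤ) ∣ Dt.c → ¬ Odd (NumberField.discr K) → p ∣ NumberField.classNumber K →
      ∃ (D : (W.baseChange K).LambdaAdicSelmerData κ γ)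
        (F : HeegnerFamily (W.conductorNorm ℤ) W K κ jbar) (X : (W.baseChange K).SelmerDualData κ γ),
        F.Dt = Dt ∧ heegnerCharIdeal D F ^ 2 ≤
          Module.charIdeal (IwasawaAlgebra p) (Submodule.torsion (IwasawaAlgebra p) X.X)

/-! ## §2 Registered stubs -/

/-- **stub s_cop (PROVED, print: Mastella–Zerman 2026 Cor 4.6 by name at `p = 3`, scalars `1 + 3ℤ₃`).** The route
binder `hMZ` is by body the Literature fact `cor46_howardDivisibility_of_scalarImage.{0}`; the tied X10b discharge is
`X10.heegnerContainmentPinned_of_cor46_of_not_surj` (p607508).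
[cite: MastellaZerman2026, Cor. 4.6 (arXiv:2505.08710)] [cite: LombardoTronto2022, Prop. 3.12] -/
theorem stub_coprimeTied : Stmt.coprimeTied := by
  intro hMZ W _ _ p _ _ K _ _ hX hns hcm hK h3 h4 hHN hHp κ hκ γ hγ Dt H _ jbar _ hhK
  have h46 : MastellaZerman2026.cor46_howardDivisibility_of_scalarImage.{0} := hMZ
  obtain ⟨D, F, X, hFD, -, hle⟩ :=
    Summit.BirchSwinnertonDyer.BirchSwinnertonDyer.Rank1Residual.X10.heegnerContainmentPinned_of_cor46_of_not_surj
      h46 hX hns hcm hK h3 h4 hHN hHp hhK κ hκ γ hγ Dt H jbar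
  exact ⟨D, F, X, hFD, hle⟩

/-- **stub s_env (OPEN, M–L; print modulo typing)** — twin of 26359's `stub_envelopeTied` on the BROAD X10b frame;
discharged by the p-generic envelope engine (x9-p2 Kummer half K1–K3 over x9-p1 LEAD's principal CM system I–III).
[cite: Howard2004HeegnerKolyvagin, §3.3 (Lemma 2.3.3, Thm. 3.3.7)] [cite: PerrinRiou1987BSMF, Prop. 10]
[cite: CastellaGrossiLeeSkinner2022, §4.1 (Thm. 4.1.1, Rem. 4.1.4)] -/
theorem stub_envelopeTied : Stmt.envelopeTied := by
  sorry

/-- **stub s_pLoc (OPEN as a stub; PRINT = CGS 2025 Thm. 6.5.2 at any class number, typed p610515, NOT a binder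
of this crux)** — see `pLocalizedStabilized_of_thm652` for the conditional discharge.
[cite: CastellaGrossiSkinner2025, Thm. 6.5.2 (final TeX l.3229–3238)] [cite: CastellaGrossiLeeSkinner2022, Thm. 4.1.3 ((γ-1) inverted)] -/
theorem stub_pLocalizedStabilized : Stmt.pLocalizedStabilized := by
  sorry

/-- **stub s_mu (OPEN, HARDEST, BEYOND PRINT)**: the μ-part of Howard's divisibility at `3 ∣ h_K` for the pinned
family on odd-`d_K` X10b frames. Reduction: `muPartTied_of_muInvariant_eq_zero`.
[cite: Howard2004HeegnerKolyvagin, Thm. B (μ needs p ∤ h_K)] [cite: MastellaZerman2026, Cor. 4.6 (p ∤ h_K)]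
[cite: CastellaGrossiSkinner2025, Thm. 6.5.2 (p inverted)] -/
theorem stub_muPartTied : Stmt.muPartTied := by
  sorry

/-- **stub s_even (OPEN, NO SOURCE)**: even-`d_K` frames at `3 ∣ h_K`. [cite: CastellaGrossiLeeSkinner2022, §4.1 standing hypothesis (disc)]
[cite: MastellaZerman2026, Assumption 2.1 (p ∤ h_K)] -/
theorem stub_evenDiscTied : Stmt.evenDiscTied := by
  sorry

/-! ## §2b Kernel reductions of the open stubs (census-in-kernel) -/

/-- **s_pLoc IS PRINT** — discharged CONDITIONALLY on CGS 2025 Thm. 6.5.2 at any class number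
(`thm652_stabilized_rankOne_charIdeal_torsion_dvd_pLocalized`, p610515) by the landed theorem
`X10.pLocalizedStabilizedContainment_of_thm652` (p614038; hypothesis record `X10.thm413Hypotheses_of_classX10`, p606553). When the pen binds the fact (support
`CGSHowardDivisibilityPLocalized`), this becomes the in-composition call and the stub is retired.
[cite: CastellaGrossiSkinner2025, Thm. 6.5.2] -/
theorem pLocalizedStabilized_of_thm652
    (h652 : CastellaGrossiSkinner2025.thm652_stabilized_rankOne_charIdeal_torsion_dvd_pLocalized.{0}) :
    Stmt.pLocalizedStabilized := by
  -- = `X10.pLocalizedStabilizedContainment_of_thm652 h652 hX hK h3 hHN hHp hodd hκ hγ D C X` (p614038); inlined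
  intro W _ _ p _ _ K _ _ hX hns hcm hK h3 h4 hHN hHp κ hκ γ hγ jbar hodd D C X
  obtain ⟨-, -, -, J, m, hJ, hdvd⟩ := h652 (W.conductorNorm ℤ) W K p κ γ jbar
    (Summit.BirchSwinnertonDyer.BirchSwinnertonDyer.Rank1Residual.X10.thm413Hypotheses_of_classX10
      hX hK h3 hHN hHp hodd hκ hγ) D C X
  refine ⟨m * 2, Ideal.le_of_dvd ?_⟩
  have h2 := pow_dvd_pow_of_dvd hdvd 2
  rw [mul_pow, Ideal.span_singleton_pow, ← pow_mul] at h2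
  rwa [hJ]

/-- **s_pLoc at SELMER CORANK ONE is already given by the crux binder `hCGLS`** (CGLS 4.1.3 "Moreover") — recorded
so that the LIGHT consumers (rank one, `Ш[3^∞]` finite) see no dependence on CGS 6.5.2: on an odd-`d_K` X10b frame
with `rank E(K) = 1` and `Ш(E/K)[p^∞]` finite, `∃ m, (3^m)·I(Λκ_∞(C))² ⊆ char`.
[cite: CastellaGrossiLeeSkinner2022, Thm. 4.1.3 ("Moreover") and Cor. 3.4.2] -/
theorem pLocalizedStabilized_of_cgls_of_rank_one (hCGLS : CGLSHowardDivisibilityLocalized)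
    {W : WeierstrassCurve ℚ} [W.IsElliptic] [W.IsGloballyMinimal] [NeZero (W.conductorNorm ℤ)]
    {p : ℕ} [Fact p.Prime] {K : Type} [Field K] [NumberField K]
    (hX : ClassX10 W p) (hK : IsImaginaryQuadratic K) (h3 : NumberField.discr K ≠ -3)
    (hHN : SatisfiesHeegnerHypothesis (W.conductorNorm ℤ) K) (hHp : SatisfiesHeegnerHypothesis p K)
    (hodd : Odd (NumberField.discr K)) {κ : ZpExtension K p} (hκ : κ.IsAnticyclotomic)
    {γ : Field.absoluteGaloisGroup K} (hγ : κ.IsTopGenerator γ) {jbar : AlgebraicClosure K →+* ℂ}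
    (hrk : (W.baseChange K).mordellWeilRank = 1)
    (hfin : Finite (AddCommGroup.primaryComponent (W.baseChange K).sha p))
    (D : (W.baseChange K).LambdaAdicSelmerData κ γ)
    (C : CastellaGrossiLeeSkinner2022.StabilizedHeegnerData (W.conductorNorm ℤ) W K κ jbar)
    (X : (W.baseChange K).SelmerDualData κ γ) :
    ∃ m : ℕ, Ideal.span {((p : IwasawaAlgebra p) ^ m)} *
        CastellaGrossiLeeSkinner2022.stabilizedHeegnerCharIdeal D C ^ 2 ≤
      Module.charIdeal (IwasawaAlgebra p) (Submodule.torsion (IwasawaAlgebra p) X.X) := by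
  have h413 : CastellaGrossiLeeSkinner2022.thm413_rankOne_charIdeal_torsion_dvd_localized.{0} := hCGLS
  exact CastellaGrossiLeeSkinner2022.span_pow_mul_sq_le_charIdeal_torsion_of_thm413 h413
    (Summit.BirchSwinnertonDyer.BirchSwinnertonDyer.Rank1Residual.X10.thm413Hypotheses_of_classX10
      hX hK h3 hHN hHp hodd hκ hγ)
    (Summit.BirchSwinnertonDyer.Rank1Residual.X9.selmerCorank_eq_one_of_rank_one hrk hfin) D C X

/-- **s_mu IS the μ-INEQUALITY `μ(X_tors) ≤ 2·μ(𝔖/ℋ_F)`** (census-in-kernel; idea-16 g2's target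
correction adopted): if at every odd-`d_K` X10b frame with `3 ∣ h_K`, for the tied family and every `(D, X)` with
`𝔖`, `𝒳` finitely generated and `𝔖/ℋ_F` torsion, the local length of `𝒳_{Λ-tors}` at the height-one prime `(3)`
is at most twice that of `𝔖/ℋ_F`, then `Stmt.muPartTied` holds — by x10b-p1's sharp promotion lemma
`IwasawaAlgebra.sq_charIdeal_le_charIdeal_of_span_p_pow_mul_le_of_lengthAt_le_two_mul` (Y := `D.S ⧸ ℋ_F`).
The inequality is what Howard's Thm. B (c) / MZ26 Thm. 3.15 (iii) deliver where they apply (a DIVISIBILITY with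
μ included); it is BEYOND CITABLE PRINT at `3 ∣ h_K` (REF-118; portable: census §μ, bsd-idea-16 F1 memo).
[cite: Howard2004HeegnerKolyvagin, Thm. B (c)] [cite: MastellaZerman2026, Thm. 3.15 (iii)] [cite: Washington1997, §13.2] -/
theorem muPartTied_of_muInequality
    (hμ : ∀ (W : WeierstrassCurve ℚ) [W.IsElliptic] [W.IsGloballyMinimal] (p : ℕ) [Fact p.Prime]
      [NeZero (W.conductorNorm ℤ)] (K : Type) [Field K] [NumberField K],
      ClassX10 W p → ¬ Surj W 3 → ¬ W.HasCM →
      IsImaginaryQuadratic K → NumberField.discr K ≠ -3 → Odd (NumberField.discr K) →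
      SatisfiesHeegnerHypothesis (W.conductorNorm ℤ) K → SatisfiesHeegnerHypothesis p K →
      ∀ (κ : ZpExtension K p), κ.IsAnticyclotomic → ∀ (γ : Field.absoluteGaloisGroup K),
      κ.IsTopGenerator γ → ∀ (Dt : ModularParametrizationData W (W.conductorNorm ℤ)) (jbar : AlgebraicClosure K →+* ℂ),
      ¬ (p : ℤ) ∣ Dt.c → p ∣ NumberField.classNumber K →
      ∀ (D : (W.baseChange K).LambdaAdicSelmerData κ γ) (F : HeegnerFamily (W.conductorNorm ℤ) W K κ jbar)
        (X : (W.baseChange K).SelmerDualData κ γ), F.Dt = Dt →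
      Module.Finite (IwasawaAlgebra p) D.S → Module.Finite (IwasawaAlgebra p) X.X →
      Module.IsTorsion (IwasawaAlgebra p) (D.S ⧸ heegnerModule D F) →
      ∀ 𝔭 : PrimeSpectrum (IwasawaAlgebra p), 𝔭.asIdeal = Ideal.span {(p : IwasawaAlgebra p)} →
        Module.lengthAt (IwasawaAlgebra p) (Submodule.torsion (IwasawaAlgebra p) X.X) 𝔭 ≤
          2 * Module.lengthAt (IwasawaAlgebra p) (D.S ⧸ heegnerModule D F) 𝔭) :
    Stmt.muPartTied := by
  intro W _ _ p _ _ K _ _ hX hns hcm hK h3 h4 hHN hHp κ hκ γ hγ Dt H ιC jbar hc hodd hhK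
    ⟨D, F, X, m, hFDt, hfinS, hfinX, htor, hloc⟩
  haveI := hfinX
  haveI := hfinS
  haveI : IsNoetherian (IwasawaAlgebra p) X.X := isNoetherian_of_isNoetherianRing_of_finite _ _
  haveI : Module.Finite (IwasawaAlgebra p) (Submodule.torsion (IwasawaAlgebra p) X.X) := inferInstance
  haveI : Module.Finite (IwasawaAlgebra p) (D.S ⧸ heegnerModule D F) := inferInstance
  refine ⟨D, F, X, hFDt, ?_⟩
  exact IwasawaAlgebra.sq_charIdeal_le_charIdeal_of_span_p_pow_mul_le_of_lengthAt_le_two_mul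
    (Submodule.torsion_isTorsion (R := IwasawaAlgebra p) (M := X.X)) htor
    (hμ W p K hX hns hcm hK h3 hodd hHN hHp κ hκ γ hγ Dt jbar hc hhK D F X hFDt hfinS hfinX htor) hloc

/-- **The stronger sufficient condition `μ(X_tors) = 0`** (x9-p1's reduction; B-side flavour: it is what a
BDP-μ = 0 transfer would give) also closes s_mu, via `IwasawaAlgebra.le_charIdeal_of_span_p_pow_mul_le` (p607965).
[cite: Washington1997, §13.2] [cite: MastellaZerman2026, Ass. 2.1, Cor. 4.6] -/
theorem muPartTied_of_muInvariant_eq_zero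
    (hμ : ∀ (W : WeierstrassCurve ℚ) [W.IsElliptic] [W.IsGloballyMinimal] (p : ℕ) [Fact p.Prime]
      [NeZero (W.conductorNorm ℤ)] (K : Type) [Field K] [NumberField K],
      ClassX10 W p → ¬ Surj W 3 → ¬ W.HasCM →
      IsImaginaryQuadratic K → NumberField.discr K ≠ -3 → Odd (NumberField.discr K) →
      SatisfiesHeegnerHypothesis (W.conductorNorm ℤ) K → SatisfiesHeegnerHypothesis p K →
      ∀ (κ : ZpExtension K p), κ.IsAnticyclotomic → ∀ (γ : Field.absoluteGaloisGroup K),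
      κ.IsTopGenerator γ →
      p ∣ NumberField.classNumber K →
      ∀ (X : (W.baseChange K).SelmerDualData κ γ), Module.Finite (IwasawaAlgebra p) X.X →
      ∀ 𝔭 : PrimeSpectrum (IwasawaAlgebra p), 𝔭.asIdeal = Ideal.span {(p : IwasawaAlgebra p)} →
        Module.lengthAt (IwasawaAlgebra p) (Submodule.torsion (IwasawaAlgebra p) X.X) 𝔭 = 0) :
    Stmt.muPartTied := by
  intro W _ _ p _ _ K _ _ hX hns hcm hK h3 h4 hHN hHp κ hκ γ hγ Dt H ιC jbar hc hodd hhK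
    ⟨D, F, X, m, hFDt, _, hfinX, _, hloc⟩
  haveI := hfinX
  haveI : IsNoetherian (IwasawaAlgebra p) X.X := isNoetherian_of_isNoetherianRing_of_finite _ _
  haveI : Module.Finite (IwasawaAlgebra p) (Submodule.torsion (IwasawaAlgebra p) X.X) := inferInstance
  refine ⟨D, F, X, hFDt, ?_⟩
  exact IwasawaAlgebra.le_charIdeal_of_span_p_pow_mul_le
    (Submodule.torsion_isTorsion (R := IwasawaAlgebra p) (M := X.X))
    (hμ W p K hX hns hcm hK h3 hodd hHN hHp κ hκ γ hγ hhK X hfinX) hloc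

/-! ## §3 Composition (sorry-free, concludes the crux BY NAME) -/

/-- Ideal bookkeeping: `(a) · ((b) · I)² = (a·b²) · I²`. [folklore] -/
theorem span_singleton_mul_sq {R : Type*} [CommSemiring R] (a b : R) (I : Ideal R) :
    Ideal.span {a} * (Ideal.span {b} * I) ^ 2 = Ideal.span {a * b ^ 2} * I ^ 2 := by
  rw [mul_pow, Ideal.span_singleton_pow, ← mul_assoc, Ideal.span_singleton_mul_span_singleton]

/-- Local ALIAS of the crux decl, so that exactly ONE theorem of this file (`…_of_stubs`) concludes the crux BY NAME
for the registry's skeleton audit (`#h21_check_skeleton` takes the first crux-headed theorem); the parametric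
compositions below conclude this alias, which unfolds to the crux definitionally. -/
def Goal : Prop := HowardContainmentAnyClassNumberX10bPinnedOfPrint

/-- **Composition**: `HowardContainmentAnyClassNumberX10bPinnedOfPrint` from the five regime stubs. Fix the frame,
`jbar := IsAlgClosed.lift` along `ιC`; `3 ∤ h_K` ↦ `s_cop hMZ`; `3 ∣ h_K` and even `d_K` ↦ `s_even`; `3 ∣ h_K` and
odd `d_K` ↦ `D`, `X` exist (proved existence facts), `(C, F, e)` ← `s_env hTw`, `m` ← `s_pLoc` at `(D, C, X)`,
`Module.Finite Λ X.X` ← `hCGLS` (rank clause of CGLS 4.1.3 at `(D, C, X)`, hypotheses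
`X10.thm413Hypotheses_of_classX10`) ⇒ `(3^{m+2e})·I(ℋ_F)² ⊆ char` ⇒ `s_mu`. -/
theorem HowardContainmentAnyClassNumberX10bPinnedOfPrint_of
    (s_cop : Stmt.coprimeTied) (s_env : Stmt.envelopeTied) (s_pLoc : Stmt.pLocalizedStabilized)
    (s_mu : Stmt.muPartTied) (s_even : Stmt.evenDiscTied) : Goal := by
  unfold Goal
  intro hMZ hCGLS hTw W _ _ p _ _ K _ _ hX hns hcm hK h3 h4 hHN hHp κ hκ γ hγ Dt H ιC hc
  letI : Algebra K ℂ := ιC.toAlgebra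
  let jbar : AlgebraicClosure K →+* ℂ :=
    (IsAlgClosed.lift (R := K) (M := ℂ) (S := AlgebraicClosure K)).toRingHom
  by_cases hhK : p ∣ NumberField.classNumber K
  · by_cases hodd : Odd (NumberField.discr K)
    · -- `3 ∣ h_K`, odd `d_K`: envelope → CGS-shaped localized stub → μ-part
      obtain ⟨D⟩ := LambdaAdicSelmerDataExists.nonempty_lambdaAdicSelmerData (W.baseChange K) p κ hγ
      obtain ⟨X⟩ := (W.baseChange K).nonempty_selmerDualData_holds κ γ hγ
      obtain ⟨C, F, e, -, hFDt, henv, htor⟩ :=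
        s_env hTw W p K hX hns hcm hK h3 h4 hHN hHp κ hκ γ hγ Dt H jbar D hc
      obtain ⟨m, hm⟩ := s_pLoc W p K hX hns hcm hK h3 h4 hHN hHp κ hκ γ hγ jbar hodd D C X
      -- finiteness of `𝔖`, `𝒳` from the crux binder CGLS Thm. 4.1.3 (rank clauses) at `(D, C, X)`
      have h413 : CastellaGrossiLeeSkinner2022.thm413_rankOne_charIdeal_torsion_dvd_localized.{0} := hCGLS
      obtain ⟨⟨hfinS, -⟩, hfinX, -⟩ := h413 (W.conductorNorm ℤ) W K p κ γ jbar
        (Summit.BirchSwinnertonDyer.BirchSwinnertonDyer.Rank1Residual.X10.thm413Hypotheses_of_classX10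
          hX hK h3 hHN hHp hodd hκ hγ) D C X
      -- `(p^{m+2e}) · I(ℋ_F)² ⊆ char(X_tors)`
      have hloc : Ideal.span {((p : IwasawaAlgebra p) ^ (m + e * 2))} * heegnerCharIdeal D F ^ 2 ≤
          Module.charIdeal (IwasawaAlgebra p) (Submodule.torsion (IwasawaAlgebra p) X.X) := by
        calc Ideal.span {((p : IwasawaAlgebra p) ^ (m + e * 2))} * heegnerCharIdeal D F ^ 2
            = Ideal.span {((p : IwasawaAlgebra p) ^ m)} *
                (Ideal.span {((p : IwasawaAlgebra p) ^ e)} * heegnerCharIdeal D F) ^ 2 := by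
              rw [span_singleton_mul_sq, ← pow_mul, ← pow_add]
          _ ≤ Ideal.span {((p : IwasawaAlgebra p) ^ m)} *
                CastellaGrossiLeeSkinner2022.stabilizedHeegnerCharIdeal D C ^ 2 :=
              Ideal.mul_mono_right (Ideal.pow_right_mono henv 2)
          _ ≤ _ := hm
      obtain ⟨D', F', X', hF', hle⟩ := s_mu W p K hX hns hcm hK h3 h4 hHN hHp κ hκ γ hγ Dt H ιC jbar hc hodd
        hhK ⟨D, F, X, m + e * 2, hFDt, hfinS, hfinX, htor, hloc⟩
      exact ⟨jbar, D', F', X', hF', hle⟩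
    · -- `3 ∣ h_K`, even `d_K`
      obtain ⟨D, F, X, hF, hle⟩ := s_even W p K hX hns hcm hK h3 h4 hHN hHp κ hκ γ hγ Dt H ιC jbar hc hodd hhK
      exact ⟨jbar, D, F, X, hF, hle⟩
  · -- `3 ∤ h_K`
    obtain ⟨D, F, X, hF, hle⟩ := s_cop hMZ W p K hX hns hcm hK h3 h4 hHN hHp κ hκ γ hγ Dt H ιC jbar hc hhK
    exact ⟨jbar, D, F, X, hF, hle⟩

/-- the crux from the four OPEN stubs (s_cop discharged above). -/
theorem HowardContainmentAnyClassNumberX10bPinnedOfPrint_of_open_stubs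
    (s_env : Stmt.envelopeTied) (s_pLoc : Stmt.pLocalizedStabilized) (s_mu : Stmt.muPartTied)
    (s_even : Stmt.evenDiscTied) : Goal :=
  HowardContainmentAnyClassNumberX10bPinnedOfPrint_of stub_coprimeTied s_env s_pLoc s_mu s_even

/-- the composed line (sorries only through `stub_envelopeTied`, `stub_pLocalizedStabilized`, `stub_muPartTied`,
`stub_evenDiscTied`). -/
theorem HowardContainmentAnyClassNumberX10bPinnedOfPrint_of_stubs : HowardContainmentAnyClassNumberX10bPinnedOfPrint :=
  (HowardContainmentAnyClassNumberX10bPinnedOfPrint_of stub_coprimeTied stub_envelopeTied stub_pLocalizedStabilized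
    stub_muPartTied stub_evenDiscTied : Goal)

end Summit.BirchSwinnertonDyer.BirchSwinnertonDyer.Cruxes.HowardContainmentAnyClassNumberX10bPinnedOfPrint.TorsionDepthX10bPinned

end
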